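import Mathlib
import Literature.NumberTheory.LFunctions.RHWave0PNTProofs
import Literature.NumberTheory.LFunctions.ChebyshevSylvesterPrimeWindows
import Summits.ValiantsHypothesis.ValiantsHypothesis.Theorems.GrenetZeonHessianRankCodimTwoBorderPlane
import Summits.ValiantsHypothesis.ValiantsHypothesis.Theorems.GrenetZeonHessianRankCodimTwoLatinGoodPlaneThreePrime
import HarnessLib

/-!
# Crux `GrenetZeon.HessianRankCodimTwo` (stmt-ValiantsHypothesis-8061), line `good_plane`, ALL large `n`:
# prime windows `(x, 1.05x]` and the composition `(★★) for all large primes ⇒ stub_goodPlanes`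

Seat val-width-8061-p3 g2, file 8 of the plan of `Cruxes/HessianRankCodimTwo/BorderedLatinAllN.md` (§0, §4, §5)
for the lead val-width-8061-p1 g2.  The bordered Latin plane of size `n = 3p + r`
(`Theorems/GrenetZeonHessianRankCodimTwoBorderDefs.lean`) is good as soon as `(★★) BordCoreNonvanishing p r`
holds and `(3p + r)² < 10 (p - 1)²` (`goodPlane_of_bordCoreNonvanishing`, file `…BorderPlane`); the case
`r = 0` is Theorem P (`goodPlane_three_mul_prime`, file `…LatinGoodPlaneThreePrime`, primes `p ≥ 13`).  To
reach EVERY large `n` one needs, for each such `n`, a prime `p` with `n = 3p + r` and `r` small compared to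
`p`; the rank inequality tolerates `r < (√10 - 3) p - O(1) ≈ 0.162 p`.  This file supplies exactly that:

* `exists_prime_Ioc_twentyOne` — for all large real `x` there is a prime in `(x, (21/20)·x]`.  Source: the
  PRIME NUMBER THEOREM `θ(x) ~ x` PROVED in the tree with the standard axioms
  (`Literature.NumberTheory.LFunctions.chebyshevTheta_isEquivalent`, file `RHWave0PNTProofs`, via the tree's
  Wiener–Ikehara theorem): `θ(x) ≤ 1.01 x < 1.0395 x ≤ θ(1.05 x)` eventually, and a positive `θ`-increment on
  `(x, b]` contains a prime (`Sylvester.exists_prime_of_theta_lt`).  The EXPLICIT windows of the tree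
  (`PrimeWindowsPNT.theta_window_ge`, `x ≥ 10⁸`, file `FordPrimeWindowsPNT`) would give an explicit `n₀` but
  rest on `native_decide` certificates (`SchoenfeldBound.lowSums_check`, `MertensCertificate.…`), so they are
  NOT used: the stub is `∃ n₀` and the crux must close with the standard axioms;
* `exists_prime_near_third` — for all large `n` there is a prime `p` with `3p ≤ n` and `20 n < 63 p` (the
  window at `x = 20n/63`, `(21/20) x = n/3`), i.e. `n = 3p + r` with `20 r < 3 p`
  (`exists_eq_three_mul_prime_add`, with `p` beyond any prescribed bound);
* `bord_rank_ineq` — `20 r ≤ 3 p`, `p ≥ 300` ⇒ `(3p + r)² < 10 (p - 1)²`;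
* `goodPlanes_of_bordCoreNonvanishing` — **if `(★★) BordCoreNonvanishing p r` holds for all primes
  `p ≥ p₀` and all `r ≥ 1` with `20 r ≤ 3 p`, then good planes exist for all large `n`**: the statement
  `stub_goodPlanes : ∃ n₀, ∀ n ≥ n₀, GoodPlane n` of `Lines/good_plane.lean`, unfolded verbatim (the form
  `goodPlanes_of_latinBlockNonvanishing` of file `…LatinPlane` also produces); variant
  `goodPlanes_of_bordCoreNonvanishing'` with the hypothesis restricted to `r + 3 ≤ p` as in the
  `…BorderDeaths*` files.

So once the lead's `(★★)` lands for all large primes, `stub_goodPlanes` — hence the crux — follows by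
`exact goodPlanes_of_bordCoreNonvanishing ⟨p₀, h⟩`.  VP ≠ VNP is not moved by anything here: the crux feeds
only the constant-factor bound `TwoDimCoefficients`.
-/

noncomputable section

open Finset MvPolynomial Filter Asymptotics
open Literature.Computability.AlgebraicComplexity
open Literature.NumberTheory.LFunctions
open scoped Chebyshev

-- single-conjunct layout `Summits/ValiantsHypothesis/ValiantsHypothesis`: duplicated namespace by design
set_option linter.dupNamespace false

namespace Summit.ValiantsHypothesis.ValiantsHypothesis.Theorems.GrenetZeonHessianRankCodimTwo

/-! ### Primes in `(x, 1.05 x]` from the prime number theorem -/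

/-- **Prime window of ratio `21/20` (PNT).** For all large real `x` there is a prime `p` with
`x < p ≤ (21/20)·x`: by `θ(x) ~ x` (`chebyshevTheta_isEquivalent`), eventually `|θ(y) - y| ≤ y/100`, so
`θ(x) ≤ 1.01 x < 1.0395 x ≤ θ((21/20) x)`, and a positive `θ`-increment on `(x, b]` contains a prime
(`Sylvester.exists_prime_of_theta_lt`). [cite: MontgomeryVaughan2007, §8.1 (8.2) and Cor. 8.8 (PNT via Wiener–Ikehara; tree form)] -/
theorem exists_prime_Ioc_twentyOne :
    ∃ x₀ : ℝ, ∀ x ≥ x₀, ∃ p : ℕ, p.Prime ∧ x < p ∧ (p : ℝ) ≤ 21 / 20 * x := by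
  have h := (chebyshevTheta_isEquivalent).isLittleO.def (show (0 : ℝ) < 1 / 100 by norm_num)
  rw [Filter.eventually_atTop] at h
  obtain ⟨x₁, hx₁⟩ := h
  refine ⟨max x₁ 1, fun x hx => ?_⟩
  have hx1 : 1 ≤ x := le_trans (le_max_right _ _) hx
  have hxx₁ : x₁ ≤ x := le_trans (le_max_left _ _) hx
  have hA := hx₁ x hxx₁
  have hB := hx₁ (21 / 20 * x) (by linarith)
  simp only [Pi.sub_apply, Real.norm_eq_abs] at hA hB
  rw [abs_of_pos (by linarith : (0 : ℝ) < x)] at hA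
  rw [abs_of_pos (by linarith : (0 : ℝ) < 21 / 20 * x)] at hB
  have hlt : θ x < θ (21 / 20 * x) := by
    have h1 := (abs_le.mp hA).2
    have h2 := (abs_le.mp hB).1
    linarith
  obtain ⟨p, hp, hxp, hpx⟩ :=
    Sylvester.exists_prime_of_theta_lt (a := x) (b := 21 / 20 * x) (by linarith) (by linarith) hlt
  exact ⟨p, hp, hxp, hpx⟩

/-- **Every large `n` is `3p + r` with `p` prime and `20 r < 3 p`.** For all large `n` there is a prime `p`
with `3 p ≤ n` and `20 n < 63 p` (a prime in `(20n/63, n/3]`, the window of ratio `21/20` at `x = 20n/63`).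
[folklore] -/
theorem exists_prime_near_third :
    ∃ n₁ : ℕ, ∀ n ≥ n₁, ∃ p : ℕ, p.Prime ∧ 3 * p ≤ n ∧ 20 * n < 63 * p := by
  obtain ⟨x₀, hx₀⟩ := exists_prime_Ioc_twentyOne
  refine ⟨⌈63 * x₀ / 20⌉₊, fun n hn => ?_⟩
  have hnr : 63 * x₀ / 20 ≤ n := le_trans (Nat.le_ceil _) (by exact_mod_cast hn)
  obtain ⟨p, hp, hxp, hpx⟩ := hx₀ (20 * (n : ℝ) / 63) (by linarith)
  refine ⟨p, hp, ?_, ?_⟩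
  · have : (3 * p : ℝ) ≤ n := by linarith
    exact_mod_cast this
  · have : (20 * n : ℝ) < 63 * p := by linarith
    exact_mod_cast this

/-- The same in the shape `n = 3p + r`, `20 r < 3 p`, with `p` beyond any prescribed bound. [folklore] -/
theorem exists_eq_three_mul_prime_add (p₀ : ℕ) :
    ∃ n₀ : ℕ, ∀ n ≥ n₀, ∃ p r : ℕ, p.Prime ∧ p₀ ≤ p ∧ n = 3 * p + r ∧ 20 * r < 3 * p := by
  obtain ⟨n₁, hn₁⟩ := exists_prime_near_third
  refine ⟨max n₁ (4 * p₀), fun n hn => ?_⟩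
  have h1 : n₁ ≤ n := le_trans (le_max_left _ _) hn
  have h2 : 4 * p₀ ≤ n := le_trans (le_max_right _ _) hn
  obtain ⟨p, hp, h3, h63⟩ := hn₁ n h1
  exact ⟨p, n - 3 * p, hp, by omega, by omega, by omega⟩

/-! ### The rank inequality -/

/-- `20 r ≤ 3 p` and `p ≥ 300` give `(3p + r)² < 10 (p - 1)²` (indeed `p ≥ 259` suffices:
`400 (3p+r)² ≤ 3969 p² < 4000 (p-1)²`). [folklore] -/
theorem bord_rank_ineq {p r : ℕ} (hp : 300 ≤ p) (hr : 20 * r ≤ 3 * p) :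
    (3 * p + r) ^ 2 < 10 * (p - 1) ^ 2 := by
  obtain ⟨q, rfl⟩ : ∃ q, p = q + 1 := ⟨p - 1, by omega⟩
  rw [Nat.add_sub_cancel]
  have h1 : 20 * (3 * (q + 1) + r) ≤ 63 * (q + 1) := by omega
  have h2 : 400 * (3 * (q + 1) + r) ^ 2 ≤ (63 * (q + 1)) ^ 2 := by
    have := Nat.mul_le_mul h1 h1
    nlinarith [this]
  have h3 : (63 * (q + 1)) ^ 2 < 4000 * q ^ 2 := by nlinarith
  nlinarith [h2, h3]

/-! ### Composition: `(★★)` for all large primes ⇒ good planes for all large `n` -/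

/-- **Good planes for all large `n` from the core non-vanishing `(★★)` at all large primes.**  If
`BordCoreNonvanishing p r` holds for every prime `p ≥ p₀` and every `r ≥ 1` with `20 r ≤ 3 p`, then
`∃ n₀, ∀ n ≥ n₀, GoodPlane n` (the registered `stub_goodPlanes` of `Lines/good_plane.lean`, unfolded):
write `n = 3p + r` by `exists_eq_three_mul_prime_add`; `r = 0` is Theorem P
(`goodPlane_three_mul_prime`), `r ≥ 1` is `goodPlane_of_bordCoreNonvanishing` with `bord_rank_ineq`.
[folklore] -/
theorem goodPlanes_of_bordCoreNonvanishing
    (h : ∃ p₀ : ℕ, ∀ p ≥ p₀, p.Prime → ∀ r : ℕ, 1 ≤ r → 20 * r ≤ 3 * p → BordCoreNonvanishing p r) :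
    ∃ n₀ : ℕ, ∀ n ≥ n₀,
      ∃ w : Fin 3 → (Fin n × Fin n → ℂ), LinearIndependent ℂ w ∧
        ∀ a : Fin 3 → ℂ, a ≠ 0 →
          MvPolynomial.eval (∑ i, a i • w i) (perPoly (Fin n) ℂ) = 0 →
            n ^ 2 < 2 * (hess0 (transl (∑ i, a i • w i) (perPoly (Fin n) ℂ))).rank := by
  obtain ⟨p₀, hP⟩ := h
  obtain ⟨n₀, hn₀⟩ := exists_eq_three_mul_prime_add (p₀ + 300)
  refine ⟨n₀, fun n hn => ?_⟩
  obtain ⟨p, r, hp, hp₀, rfl, h20⟩ := hn₀ n hn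
  rcases Nat.eq_zero_or_pos r with rfl | hr
  · exact goodPlane_three_mul_prime hp (le_trans (Nat.le_add_left 13 (p₀ + 287)) hp₀)
  · have hp300 : 300 ≤ p := le_trans (Nat.le_add_left 300 p₀) hp₀
    have hpp₀ : p₀ ≤ p := le_trans (Nat.le_add_right p₀ 300) hp₀
    have hp2 : 2 ≤ p := le_trans (by norm_num) hp300
    have hineq : (3 * p + r) ^ 2 < 10 * (p - 1) ^ 2 := bord_rank_ineq hp300 h20.le
    exact goodPlane_of_bordCoreNonvanishing hp2 hineq (hP p hpp₀ hp r hr h20.le)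

/-- Variant with the hypothesis in the range `1 ≤ r ≤ p - 3` of the `…BorderDeaths*` files
(`20 r ≤ 3 p` and `p ≥ 60` imply `r + 3 ≤ p`). [folklore] -/
theorem goodPlanes_of_bordCoreNonvanishing'
    (h : ∃ p₀ : ℕ, ∀ p ≥ p₀, p.Prime → ∀ r : ℕ, 1 ≤ r → r + 3 ≤ p → BordCoreNonvanishing p r) :
    ∃ n₀ : ℕ, ∀ n ≥ n₀,
      ∃ w : Fin 3 → (Fin n × Fin n → ℂ), LinearIndependent ℂ w ∧
        ∀ a : Fin 3 → ℂ, a ≠ 0 →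
          MvPolynomial.eval (∑ i, a i • w i) (perPoly (Fin n) ℂ) = 0 →
            n ^ 2 < 2 * (hess0 (transl (∑ i, a i • w i) (perPoly (Fin n) ℂ))).rank := by
  obtain ⟨p₀, hP⟩ := h
  refine goodPlanes_of_bordCoreNonvanishing ⟨p₀ + 60, fun p hp hprime r hr h20 => ?_⟩
  exact hP p (le_trans (Nat.le_add_right p₀ 60) hp) hprime r hr (by omega)

end Summit.ValiantsHypothesis.ValiantsHypothesis.Theorems.GrenetZeonHessianRankCodimTwo
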